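/- Copyright: the b2b-balaban cell (near-miss cell 7), T⁴-continuum fan-out; row NE7b OWNER lineage `t4-ne7b-p1`
(gen 60) — «(d2′) ON THE COUNT SIDE: THE CHAIN CLOCK IS BOOKED», part 4 (memory-agnostic form; kernel item of RULING
R-OWNER-60-1).  Released under the licence of the surrounding project. -/
import Summits.QuantumFields.BalabanUV.T4Continuum.Support.HistoryReadinessChainRealisePrint

/-!
# Realised histories on print's CHAIN CLOCK, MEMORY-AGNOSTIC FORM: the renewal clause asks only the chain's two
consecutive (i)-scales at readiness, so EVERY memory convention bounded by the frozen one (frozen `R t`, print's current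
`R (t + k)`, any `Rm t k ≤ R t`) is booked by `dictW` with the letters of record (row NE7b, R-OWNER-60-1, part 4;
parts 1–3 = `HistoryReadinessChainWindows` ∕ `…Realise` ∕ `…RealisePrint`; the chain-clock analogue of repair R-41-a's
`HistoryRealiseWeak`)

Summits-side support leaf of the T⁴-continuum cell (rung (B)+1 on a FINITE torus only; NOT infinite volume, NOT the
mass gap, NOT the Clay statement; NOT a proof of the spine estimate NE7b — the cell's OWN estimate, NOT PRINTED, NOT
PROVED).  [folklore] finite combinatorics in the ℤᵈ INDEX MODEL over parts 1–3; no `[cite:]` tag, no `Prop` fact of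
Bałaban's minted (the one `def` is a PREDICATE with parameters — `HistoryRealiseWeak.RealisesW` re-clocked), zero
`sorry`.  B15 = [Balaban1989LargeFieldI] pp. 177, 198 and B16 = [Balaban1989LargeFieldII] pp. 384–386 are manuscripts
UNDER AUDIT and appear only as LOCATORS.

WHY (reading item (d3) «which memory the readiness test reads»; R-OWNER-41-1's repair R-41-a for the tree clock).  Parts
2∕3 read every readiness with the FROZEN memory `N = R t` of the line's last event (`StopsC L s R t Z k := StopAtC 100
(R t) ⊤ (orbit …) k`).  Print reads `N = R_j` at the level the test is made ([B16] p. 384 «with N = R_j» re-made at every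
level through (1.83); [B15] p. 198 «N to the positive power of log g_k^{−2}»), and the cell's process of record
(`HistoryGenealogyInstantiateM`) carries a general memory function `Rm` (`HistoryRealiseMemory.StopsM`).  Rather than
twin the realisation predicate per convention, THIS FILE removes the convention from the renewal clause, exactly as
`HistoryRealiseWeak` did for the tree clock: a RENEWAL at `h + 1` of a line with last event `t < h` is realised iff
the line's images at the TWO CONSECUTIVE scales `h − 1`, `h` satisfy condition (i) — what a chain-stop at `h − t` for
ANY memory `N ≥ 1` supplies (part 1's `condI_pred_of_stopAtC`) — and the line did not chain-stop (frozen memory) at any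
index `< h − t` (what chain-pendency for any memory `≤ R t` implies, the frozen chain-stop being the hardest).  The two
consecutive (i)-scales are all the renewal step of part 2 consumes (`stopsC_renew_of_pair`), so the lifetime theorem
holds VERBATIM: `exists_stopC_lt_reach_W`, letters `L ≥ 4`, `R ≥ 1`, `n₁ ≥ 13`, `dictW` UNTOUCHED.  Net, with parts
2∕3 and R-41-a: the COUNT's booking is indifferent to the clock (tree ∕ chain) AND to the memory convention.

WHAT.  §1 `stopsC_renew_of_pair` (history-free renewal step from two consecutive (i)-scales).  §2 `RealisesCW`,
`realisesCW_of_realisesPC` (∕ `_of_realisesC`), **`realisesCW_renew_of_stopAtC`** (the lemma every memory convention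
instantiates).  §3 **`exists_stopC_lt_reach_W`** (MAIN), `lt_reach_of_pendingBeforeC_W`, `lt_reach_of_pendingAtC_W`,
`renew_lt_reach_CW`, `joinInLife_of_realisesCW`, `adm_of_realisesCW`.  §4 sanity.

HONEST SCOPE.  Index-model combinatorics on hypothesis shapes; the process of record (clock `StopsM`) NOT edited, no
carrier twinned; nothing of Bałaban's asserted, instantiated or discharged; census NONE; R∕T rows by count UNCHANGED;
(d3) itself (which memory print uses) stays a READING — what is certified is that the count does not care.  NE7b NOT
PRINTED ∕ NOT PROVED; spine 0∕9.  HONEST DEPENDENCY (cell): continuum YM on T⁴ ⇐ BetaPertH ∧ nine spine estimates (0/9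
proved); BetaPertH ⇐ (D1) ∧ (D4) ∧ CAP+tail; G-an2-4 gates asym, D1 and NE2/3/4.  This file changes none of it.
-/

open Finset
open Literature.MathematicalPhysics.QuantumFieldTheory.Balaban1983to89
open Literature.MathematicalPhysics.QuantumFieldTheory.Balaban1983to89.B13ScaleTransfer
open Literature.MathematicalPhysics.QuantumFieldTheory.Balaban1983to89.TreeLength
open Literature.MathematicalPhysics.QuantumFieldTheory.Balaban1983to89.B16SProfile
open Literature.MathematicalPhysics.QuantumFieldTheory.Balaban1983to89.B16StoppingRule
open Literature.MathematicalPhysics.QuantumFieldTheory.Balaban1983to89.B16MergeGeometry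
open Literature.MathematicalPhysics.QuantumFieldTheory.Balaban1983to89.B16MergeHorizon
open T4PersistenceDictionary
open Summit.QuantumFields.BalabanUV.T4Continuum.HistoryAdmissible
open Summit.QuantumFields.BalabanUV.T4Continuum.HistoryWindows
open Summit.QuantumFields.BalabanUV.T4Continuum.HistoryRealise
open Summit.QuantumFields.BalabanUV.T4Continuum.HistoryReadinessChainScale
open Summit.QuantumFields.BalabanUV.T4Continuum.HistoryReadinessChainWindows
open Summit.QuantumFields.BalabanUV.T4Continuum.HistoryReadinessChainRealise
open Summit.QuantumFields.BalabanUV.T4Continuum.HistoryReadinessChainRealisePrint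

namespace Summit.QuantumFields.BalabanUV.T4Continuum.HistoryReadinessChainRealiseWeak

noncomputable section

variable {d : ℕ}

/-! ## §1 The renewal step from two consecutive (i)-scales -/

section Flow

variable {L : ℕ} {s R : ℕ → ℕ} (hL : 4 ≤ L) (hdrop : ∀ m, DropCtl s m) (hR : ∀ t, 1 ≤ R t)
include hL hdrop hR

omit hR in
/-- two consecutive (i)-scales `K − 1, K` (`K ≥ 1`) of a line's orbit give condition (i) at EVERY later index (part 1's
`condI_from_pair` on the flow read from `t`, every horizon). [folklore] -/
theorem condI_orbit_of_pair {t : ℕ} {Z : Finset (Pt d)} {K : ℕ} (hK : 0 < K) (h1 : CondI 100 (orbit L s t Z (K - 1)))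
    (h2 : CondI 100 (orbit L s t Z K)) : ∀ l, K - 1 ≤ l → CondI 100 (orbit L s t Z l) := fun l hl =>
  condI_from_pair (by omega) (dropCtl_from hdrop t l) (X := orbit L s t Z) (fun l => orbit_succ L s t Z l) hK h1 h2 l
    hl le_rfl

/-- **THE RENEWAL STEP ON THE CHAIN CLOCK FROM TWO CONSECUTIVE (i)-SCALES, HISTORY- AND MEMORY-FREE**: if the line formed
at `t < h` has condition (i) at the scales `h − 1` and `h`, the RENEWED line — formed at `h + 1`, domain = the image at
`h + 1` — chain-stops (frozen memory `R (h + 1)`) at EXACTLY `R_{h+1}`. [folklore] -/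
theorem stopsC_renew_of_pair {t h : ℕ} {ZG : Finset (Pt d)} (ht : t < h) (h1 : CondI 100 (orbit L s t ZG (h - t - 1)))
    (h2 : CondI 100 (orbit L s t ZG (h - t))) : StopsC L s R (h + 1) (orbit L s t ZG (h + 1 - t)) (R (h + 1)) := by
  have hall := condI_orbit_of_pair hL hdrop (K := h - t) (by omega) (by simpa using h1) h2
  have hsh : ∀ l, orbit L s (h + 1) (orbit L s t ZG (h + 1 - t)) l = orbit L s t ZG (h + 1 - t + l) := by
    intro l
    rw [orbit_add, show t + (h + 1 - t) = h + 1 by omega]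
  show StopAtC 100 (R (h + 1)) (fun _ => True) (orbit L s (h + 1) (orbit L s t ZG (h + 1 - t))) (R (h + 1))
  refine ⟨⟨hR (h + 1), ?_, le_rfl, fun l _ _ => ⟨trivial, ?_⟩⟩, ?_⟩
  · rw [hsh]; exact hall _ (by omega)
  · rw [hsh]; exact hall _ (by omega)
  · rw [hsh]; exact hall _ (by omega)

end Flow

/-! ## §2 Realised histories on the chain clock, memory-agnostic form -/

/-- **REALISED HISTORIES ON THE CHAIN CLOCK, MEMORY-AGNOSTIC FORM.**  A NEW REGION (as everywhere); a RENEWAL at `h + 1`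
of a line with last event `t < h` whose images at the two consecutive scales `h − 1`, `h` satisfy condition (i) (what a
chain-stop at `h − t` for ANY memory `N ≥ 1` supplies), which did not chain-stop (frozen memory) at any index `< h − t`,
the new domain being the image at `h + 1`; a JOIN at `s` of two lines chain-pending (frozen memory) STRICTLY BEFORE `s`
whose current images touch, the joined domain inside their union (part 3's print-exact clause). [folklore] -/
def RealisesCW (L : ℕ) (s : ℕ → ℕ) (R : ℕ → ℕ) : PGen (Pt d × Finset (Pt d)) → Finset (Pt d) → Prop
  | .birth _ cls zZ, Z => zZ.2 = Z ∧ zZ.1 ∈ Z ∧ FaceConnected Z ∧ treeLen Z ≤ cls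
  | .renew G h, Z => ∃ ZG, RealisesCW L s R G ZG ∧ G.lastStep < h ∧
      CondI 100 (orbit L s G.lastStep ZG (h - G.lastStep - 1)) ∧ CondI 100 (orbit L s G.lastStep ZG (h - G.lastStep)) ∧
      (∀ k, k < h - G.lastStep → ¬ StopsC L s R G.lastStep ZG k) ∧ Z = orbit L s G.lastStep ZG (h + 1 - G.lastStep)
  | .join X Y sj, Z => ∃ ZX ZY, RealisesCW L s R X ZX ∧ RealisesCW L s R Y ZY ∧ X.lastStep ≤ sj ∧ Y.lastStep ≤ sj ∧
      PendingBeforeC L s R X.lastStep ZX sj ∧ PendingBeforeC L s R Y.lastStep ZY sj ∧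
      (∃ a ∈ orbit L s X.lastStep ZX (sj - X.lastStep), ∃ c ∈ orbit L s Y.lastStep ZY (sj - Y.lastStep), Touch a c) ∧
      Z ⊆ orbit L s X.lastStep ZX (sj - X.lastStep) ∪ orbit L s Y.lastStep ZY (sj - Y.lastStep)

/-- **PART 3's PREDICATE IMPLIES THE MEMORY-AGNOSTIC ONE** (a frozen-memory chain-stop at `h − t` gives `t < h` and the two
consecutive (i)-scales, part 1's `condI_pred_of_stopAtC`). [folklore] -/
theorem realisesCW_of_realisesPC {L : ℕ} {s R : ℕ → ℕ} (hR : ∀ t, 1 ≤ R t) :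
    ∀ (P : PGen (Pt d × Finset (Pt d))) (Z : Finset (Pt d)), RealisesPC L s R P Z → RealisesCW L s R P Z
  | .birth _ _ _, _, h => h
  | .renew G h, Z, hP => by
      obtain ⟨ZG, hG, hready, hfirst, hZ⟩ := hP
      have := hready.pos
      exact ⟨ZG, realisesCW_of_realisesPC hR G ZG hG, by omega, condI_pred_of_stopAtC (hR _) hready, hready.1.2.1,
        hfirst, hZ⟩
  | .join X Y sj, Z, hP => by
      obtain ⟨ZX, ZY, hX, hY, htX, htY, hpX, hpY, hac, hZ⟩ := hP
      exact ⟨ZX, ZY, realisesCW_of_realisesPC hR X ZX hX, realisesCW_of_realisesPC hR Y ZY hY, htX, htY, hpX, hpY, hac,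
        hZ⟩

/-- part 2's predicate implies the memory-agnostic one [folklore] -/
theorem realisesCW_of_realisesC {L : ℕ} {s R : ℕ → ℕ} (hR : ∀ t, 1 ≤ R t) (P : PGen (Pt d × Finset (Pt d)))
    (Z : Finset (Pt d)) (h : RealisesC L s R P Z) : RealisesCW L s R P Z :=
  realisesCW_of_realisesPC hR P Z (realisesPC_of_realisesC P Z h)

/-- **THE LEMMA EVERY MEMORY CONVENTION INSTANTIATES**: a renewal at `h + 1` of a `RealisesCW`-realised line with last
event `t`, justified by a CHAIN-stop of its orbit at `h − t` for ANY memory `N ≥ 1` (any cleanliness predicate —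
frozen `R t`, print's current `R h`, any `Rm t (h − t)`), together with frozen-memory chain-pendency before `h`, is
`RealisesCW`-realised by the image at `h + 1`. [folklore] -/
theorem realisesCW_renew_of_stopAtC {L : ℕ} {s R : ℕ → ℕ} {G : PGen (Pt d × Finset (Pt d))} {ZG : Finset (Pt d)}
    (hG : RealisesCW L s R G ZG) {h N : ℕ} (hN : 1 ≤ N) {Clean : ℕ → Prop}
    (hstop : StopAtC 100 N Clean (orbit L s G.lastStep ZG) (h - G.lastStep))
    (hfirst : ∀ k, k < h - G.lastStep → ¬ StopsC L s R G.lastStep ZG k) :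
    RealisesCW L s R (.renew G h) (orbit L s G.lastStep ZG (h + 1 - G.lastStep)) := by
  have hpos : 0 < h - G.lastStep := hstop.1.1
  exact ⟨ZG, hG, by omega, condI_pred_of_stopAtC hN hstop, hstop.1.2.1, hfirst, rfl⟩

/-! ## §3 Every memory-agnostically realised chain-clock history chain-stops strictly inside its booked life -/

section Main

variable {L : ℕ} {s R : ℕ → ℕ} (hL : 4 ≤ L) (hdrop : ∀ m, DropCtl s m) (hR : ∀ t, 1 ≤ R t) {n₁ : ℕ} (hn₁ : 13 ≤ n₁)
include hL hdrop hR hn₁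

/-- **MAIN THEOREM, MEMORY-AGNOSTIC CHAIN-CLOCK FORM.**  Every `RealisesCW`-realised history chain-stops (frozen memory)
at some `k ≥ 1` with `lastStep + k < toGen.reach (dictW R n₁)` (`L ≥ 4`, drop control, sizes `R ≥ 1`, allowance
`n₁ ≥ 13`; `dictW` untouched).  Part 3's proof verbatim, the renewal case reading the two consecutive (i)-scales off the
clause (`stopsC_renew_of_pair`). [folklore] -/
theorem exists_stopC_lt_reach_W :
    ∀ (P : PGen (Pt d × Finset (Pt d))) (Z : Finset (Pt d)), RealisesCW L s R P Z →
      ∃ k, 1 ≤ k ∧ StopsC L s R P.lastStep Z k ∧ P.lastStep + k < P.toGen.reach (dictW R n₁)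
  | .birth j cls zZ, Z, hRZ => exists_stopC_lt_reach hL hdrop hR hn₁ (.birth j cls zZ) Z hRZ
  | .renew G h, Z, hRZ => by
      obtain ⟨ZG, -, ht, h1, h2, -, rfl⟩ := hRZ
      refine ⟨R (h + 1), hR (h + 1), stopsC_renew_of_pair hL hdrop hR ht h1 h2, ?_⟩
      have h3 := restart_lt_dictW R n₁ (h + 1)
      simp only [PGen.lastStep, PGen.toGen, Gen.reach_renew]
      omega
  | .join X Y sj, Z, hRZ => by
      obtain ⟨ZX, ZY, hX, hY, htX, htY, hpX, hpY, ⟨a, ha, c, hc, hac⟩, hZ⟩ := hRZ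
      obtain ⟨kX, hkX1, hsX, hrX⟩ := exists_stopC_lt_reach_W X ZX hX
      obtain ⟨kY, hkY1, hsY, hrY⟩ := exists_stopC_lt_reach_W Y ZY hY
      set tX := X.lastStep
      set tY := Y.lastStep
      have hKX : sj - tX ≤ kX := by
        by_contra hlt; exact hpX.2 kX (by omega) hsX
      have hKY : sj - tY ≤ kY := by
        by_contra hlt; exact hpY.2 kY (by omega) hsY
      have hXI : ∀ m, tX + kX - sj - 1 ≤ m →
          CondI 100 (Siter (ratio L fun i => s (sj + i)) m (orbit L s tX ZX (sj - tX))) := by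
        intro m hm
        have h := condI_orbit_of_stopsC hL hdrop hR hsX ((sj - tX) + m) (by omega)
        rw [orbit_add, show tX + (sj - tX) = sj by omega] at h
        exact h
      have hYI : ∀ m, tY + kY - sj - 1 ≤ m →
          CondI 100 (Siter (ratio L fun i => s (sj + i)) m (orbit L s tY ZY (sj - tY))) := by
        intro m hm
        have h := condI_orbit_of_stopsC hL hdrop hR hsY ((sj - tY) + m) (by omega)
        rw [orbit_add, show tY + (sj - tY) = sj by omega] at h
        exact h
      obtain ⟨k, hk1, hkle, hstop⟩ := stopAtC_join' (show 3 ≤ L by omega)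
        (dropCtl_from hdrop sj (max (tX + kX - sj) (tY + kY - sj) + 13 + R sj)) ha hc hac
        (K₁ := tX + kX - sj) (K₂ := tY + kY - sj)
        (fun m hm => hXI m (by omega)) (fun m hm => hYI m (by omega)) (N := R sj) (fun _ => True)
        (fun _ _ _ => trivial) le_rfl
      refine ⟨k, hk1, ?_, ?_⟩
      · apply StopsC.subset hZ
        show StopAtC 100 (R sj) (fun _ => True)
          (orbit L s sj (orbit L s tX ZX (sj - tX) ∪ orbit L s tY ZY (sj - tY))) k
        exact hstop
      · have h := join_lt_dictW R hn₁ sj (r₁ := X.toGen.reach (dictW R n₁)) (r₂ := Y.toGen.reach (dictW R n₁)) hkle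
          (by omega) (by omega)
        simp only [PGen.lastStep, PGen.toGen, Gen.reach_merge]
        exact h

/-- **CHAIN-PENDING STRICTLY BEFORE THE CUTOFF ⇒ INSIDE THE BOOKED LIFE**, memory-agnostic form. [folklore] -/
theorem lt_reach_of_pendingBeforeC_W {P : PGen (Pt d × Finset (Pt d))} {Z : Finset (Pt d)}
    (hP : RealisesCW L s R P Z) {K : ℕ} (hK : PendingBeforeC L s R P.lastStep Z K) :
    K < P.toGen.reach (dictW R n₁) := by
  obtain ⟨k, -, hs, hlt⟩ := exists_stopC_lt_reach_W hL hdrop hR hn₁ P Z hP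
  have : K - P.lastStep ≤ k := by
    by_contra hlt'; exact hK.2 k (by omega) hs
  have := hK.1
  omega

/-- the same from chain-pendency THROUGH the cutoff (part 2's clause) [folklore] -/
theorem lt_reach_of_pendingAtC_W {P : PGen (Pt d × Finset (Pt d))} {Z : Finset (Pt d)} (hP : RealisesCW L s R P Z)
    {K : ℕ} (hK : PendingAtC L s R P.lastStep Z K) : K < P.toGen.reach (dictW R n₁) :=
  lt_reach_of_pendingBeforeC_W hL hdrop hR hn₁ hP (pendingBeforeC_of_pendingAtC hK)

/-- a renewal happens strictly inside the booked life of the renewed line, memory-agnostic form [folklore] -/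
theorem renew_lt_reach_CW {G : PGen (Pt d × Finset (Pt d))} {h : ℕ} {Z : Finset (Pt d)}
    (hP : RealisesCW L s R (.renew G h) Z) : h < G.toGen.reach (dictW R n₁) := by
  obtain ⟨ZG, hG, ht, -, -, hfirst, -⟩ := hP
  obtain ⟨k, -, hs, hlt⟩ := exists_stopC_lt_reach_W hL hdrop hR hn₁ G ZG hG
  have : h - G.lastStep ≤ k := by
    by_contra hlt'; exact hfirst k (by omega) hs
  omega

/-- **`JoinInLife`, MEMORY-AGNOSTIC CHAIN-CLOCK FORM.** [folklore] -/
theorem joinInLife_of_realisesCW :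
    ∀ (P : PGen (Pt d × Finset (Pt d))) (Z : Finset (Pt d)), RealisesCW L s R P Z → P.JoinInLife (dictW R n₁)
  | .birth _ _ _, _, _ => trivial
  | .renew G h, Z, hP => by
      obtain ⟨ZG, hG, -, -, -, -, -⟩ := hP
      exact joinInLife_of_realisesCW G ZG hG
  | .join X Y sj, Z, hP => by
      obtain ⟨ZX, ZY, hX, hY, -, -, hpX, hpY, -, -⟩ := hP
      exact ⟨joinInLife_of_realisesCW X ZX hX, joinInLife_of_realisesCW Y ZY hY,
        lt_reach_of_pendingBeforeC_W hL hdrop hR hn₁ hX hpX, lt_reach_of_pendingBeforeC_W hL hdrop hR hn₁ hY hpY⟩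

end Main

/-- **`Adm`, MEMORY-AGNOSTIC CHAIN-CLOCK FORM.** [folklore] -/
theorem adm_of_realisesCW {L : ℕ} {s R : ℕ → ℕ} :
    ∀ (P : PGen (Pt d × Finset (Pt d))) (Z : Finset (Pt d)), RealisesCW L s R P Z →
      ∀ {K : ℕ}, P.lastStep ≤ K → P.Adm K
  | .birth _ _ _, _, _, _, hK => hK
  | .renew G h, Z, hP, K, hK => by
      obtain ⟨ZG, hG, ht, -, -, -, -⟩ := hP
      simp only [PGen.lastStep] at hK
      exact ⟨adm_of_realisesCW G ZG hG (by omega), by omega, hK⟩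
  | .join X Y sj, Z, hP, K, hK => by
      obtain ⟨ZX, ZY, hX, hY, htX, htY, -, -, -, -⟩ := hP
      exact ⟨adm_of_realisesCW X ZX hX (htX.trans hK), adm_of_realisesCW Y ZY hY (htY.trans hK), htX, htY, hK⟩

/-! ## §4 Sanity -/

namespace Sanity

open B16MergeGeometry.OneDim

/-- the unit region is `RealisesCW`-realised [folklore] -/
theorem realisesCW_unit (L : ℕ) (s R : ℕ → ℕ) : RealisesCW L s R HistoryRealise.Sanity.unit {pt 0} :=
  ⟨rfl, mem_singleton_self _,
    fun x hx y hy => by rw [mem_singleton] at hx hy; subst hx; subst hy; exact Relation.ReflTransGen.refl,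
    by rw [treeLen_singleton]; norm_num⟩

/-- a numeric instance of the main theorem's letters (`L = 13`, constant exponents, `R ≡ 2`, `n₁ = 13`). [folklore] -/
example : ∃ k, 1 ≤ k ∧ StopsC 13 (fun _ => 0) (fun _ => 2) 0 ({pt 0} : Finset (Pt 1)) k ∧
    0 + k < (HistoryRealise.Sanity.unit).toGen.reach (dictW (fun _ => 2) 13) :=
  exists_stopC_lt_reach_W (by norm_num) (fun m i k _ _ => by simp) (fun _ => by norm_num) le_rfl
    HistoryRealise.Sanity.unit {pt 0} (realisesCW_unit 13 _ _)

/-- **THE ABSTRACT SHAPE OF A RENEWAL THAT IS `RealisesCW`- BUT NOT `RealisesPC`-REALISABLE AT A GIVEN INDEX**: the two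
consecutive (i)-scales at `h − 1`, `h` WITHOUT a frozen-memory chain-stop at `h − t` (a window shorter than `R t`, e.g.
print's current memory `R h < R t` across a drop) — the memory-agnostic clause accepts it, by `realisesCW_renew_of_stopAtC`
with the shorter memory. [folklore] -/
example {L : ℕ} {s R : ℕ → ℕ} {G : PGen (Pt d × Finset (Pt d))} {ZG : Finset (Pt d)} (hG : RealisesCW L s R G ZG)
    {h : ℕ} (hstop : StopAtC 100 1 (fun _ => True) (orbit L s G.lastStep ZG) (h - G.lastStep))
    (hfirst : ∀ k, k < h - G.lastStep → ¬ StopsC L s R G.lastStep ZG k) :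
    RealisesCW L s R (.renew G h) (orbit L s G.lastStep ZG (h + 1 - G.lastStep)) :=
  realisesCW_renew_of_stopAtC hG le_rfl hstop hfirst

end Sanity

/-! ## §5 Memory antitonicity of the chain stopping property (X-read C-ne7bleaf03g52-1, INFO-1; leaf-03 g52 at the
owner's disposal — appended only on his word)

`StopAtC` is ANTITONE in its memory: the `StopAt` half is `CondII`'s monotonicity, and the new bottom scale `K − N′`
is `K` itself at `N′ = 0`, else lies in `CondII`'s window `(K − N, K]`.  Hence THE FROZEN CHAIN-STOP IS THE HARDEST:
for every memory function `Rm : ℕ → ℕ → ℕ` (formation step, relative index) dominated by the frozen one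
(`Rm t k ≤ R t`), a frozen chain-stop is an `Rm`-chain-stop, `Rm`-chain-pendency strictly before an index implies
frozen chain-pendency there, and the FIRST `Rm`-chain-stop (any `1 ≤ Rm t k ≤ R t`: frozen `R t`, print's current
`R (t + k)` for a non-increasing `R`, …) instantiates `realisesCW_renew_of_stopAtC` — the module docstring's «EVERY
memory convention bounded by the frozen one is booked» as a theorem of the file rather than of its reader.  Plus the
display `condI_of_realisesCW_renew` (part 2's `condI_of_realisesC_renew` for `RealisesCW`).  [folklore] index
arithmetic on hypothesis shapes; nothing of Bałaban's asserted; census NONE; NE7b NOT PRINTED ∕ NOT PROVED. -/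

section Memory

variable {L : ℕ} {s R : ℕ → ℕ}

/-- **`StopAtC` is antitone in the memory**: `N′ ≤ N → StopAtC Nsz N C X K → StopAtC Nsz N′ C X K`. [folklore] -/
theorem stopAtC_antitone_mem {Nsz N N' : ℕ} {Clean : ℕ → Prop} {X : ℕ → Finset (Pt d)} {K : ℕ} (hN : N' ≤ N)
    (h : StopAtC Nsz N Clean X K) : StopAtC Nsz N' Clean X K := by
  obtain ⟨⟨hK, hIK, hNK, hall⟩, hlow⟩ := h
  refine ⟨⟨hK, hIK, le_trans hN hNK, fun l hl hlk => hall l (by omega) hlk⟩, ?_⟩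
  rcases hN.lt_or_eq with hlt | rfl
  · rcases Nat.eq_zero_or_pos N' with h0 | hpos
    · subst h0; simpa using hIK
    · exact (hall (K - N') (by omega) (by omega)).2
  · exact hlow

/-- **the frozen chain-stop is the hardest**: a frozen chain-stop is an `Rm`-chain-stop for every memory function
dominated by the frozen one. [folklore] -/
theorem stopAtC_mem_of_stopsC {Rm : ℕ → ℕ → ℕ} (hRm : ∀ t k, Rm t k ≤ R t) {t₀ : ℕ} {Z : Finset (Pt d)} {k : ℕ}
    (h : StopsC L s R t₀ Z k) : StopAtC 100 (Rm t₀ k) (fun _ => True) (orbit L s t₀ Z) k :=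
  stopAtC_antitone_mem (hRm t₀ k) h

/-- `Rm`-chain-pendency strictly before an index implies FROZEN chain-pendency there (the `hfirst` slot of
`realisesCW_renew_of_stopAtC`). [folklore] -/
theorem not_stopsC_of_not_stopAtC_mem {Rm : ℕ → ℕ → ℕ} (hRm : ∀ t k, Rm t k ≤ R t) {t₀ : ℕ} {Z : Finset (Pt d)}
    {K : ℕ} (h : ∀ k, k < K → ¬ StopAtC 100 (Rm t₀ k) (fun _ => True) (orbit L s t₀ Z) k) :
    ∀ k, k < K → ¬ StopsC L s R t₀ Z k :=
  fun k hk hS => h k hk (stopAtC_mem_of_stopsC hRm hS)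

/-- **THE `Rm`-READING INSTANTIATES `realisesCW_renew_of_stopAtC`**: a renewal at `h + 1` justified by the FIRST
`Rm`-chain-stop of the line's orbit at `h − t`, for ANY memory function with `1 ≤ Rm t k ≤ R t`, is
`RealisesCW`-realised by the image at `h + 1`. [folklore] -/
theorem realisesCW_renew_of_stopAtC_mem {Rm : ℕ → ℕ → ℕ} (hRm : ∀ t k, Rm t k ≤ R t) (hRm1 : ∀ t k, 1 ≤ Rm t k)
    {G : PGen (Pt d × Finset (Pt d))} {ZG : Finset (Pt d)} (hG : RealisesCW L s R G ZG) {h : ℕ}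
    (hstop : StopAtC 100 (Rm G.lastStep (h - G.lastStep)) (fun _ => True) (orbit L s G.lastStep ZG) (h - G.lastStep))
    (hfirst : ∀ k, k < h - G.lastStep → ¬ StopAtC 100 (Rm G.lastStep k) (fun _ => True) (orbit L s G.lastStep ZG) k) :
    RealisesCW L s R (.renew G h) (orbit L s G.lastStep ZG (h + 1 - G.lastStep)) :=
  realisesCW_renew_of_stopAtC hG (hRm1 _ _) hstop (not_stopsC_of_not_stopAtC_mem hRm hfirst)

/-- the CURRENT-memory instance (print's «N = R_j» read at the acting level, [B16] p. 384 as LOCATOR) for a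
NON-INCREASING `R ≥ 1` ([B15] p. 177 «R_k decreases» — a displayed hypothesis). [folklore] -/
theorem realisesCW_renew_of_stopAtC_cur (hR : ∀ t, 1 ≤ R t) (hmono : ∀ a b, a ≤ b → R b ≤ R a)
    {G : PGen (Pt d × Finset (Pt d))} {ZG : Finset (Pt d)} (hG : RealisesCW L s R G ZG) {h : ℕ}
    (hstop : StopAtC 100 (R (G.lastStep + (h - G.lastStep))) (fun _ => True) (orbit L s G.lastStep ZG)
      (h - G.lastStep))
    (hfirst : ∀ k, k < h - G.lastStep →
      ¬ StopAtC 100 (R (G.lastStep + k)) (fun _ => True) (orbit L s G.lastStep ZG) k) :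
    RealisesCW L s R (.renew G h) (orbit L s G.lastStep ZG (h + 1 - G.lastStep)) :=
  realisesCW_renew_of_stopAtC_mem (Rm := fun t k => R (t + k)) (fun t k => hmono t (t + k) (Nat.le_add_right t k))
    (fun t k => hR (t + k)) hG hstop hfirst

/-- **display**: the domain of a `RealisesCW`-renewed line satisfies condition (i) at the renewal scale (part 2's
`condI_of_realisesC_renew` for the memory-agnostic predicate; [B16] p. 386 l. 3–4 as LOCATOR). [folklore] -/
theorem condI_of_realisesCW_renew (hL : 4 ≤ L) (hdrop : ∀ m, DropCtl s m) {G : PGen (Pt d × Finset (Pt d))} {h : ℕ}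
    {Z : Finset (Pt d)} (hP : RealisesCW L s R (.renew G h) Z) : CondI 100 Z := by
  obtain ⟨ZG, -, ht, h1, h2, -, rfl⟩ := hP
  exact condI_orbit_of_pair hL hdrop (K := h - G.lastStep) (by omega) h1 h2 _ (by omega)

end Memory

end

end Summit.QuantumFields.BalabanUV.T4Continuum.HistoryReadinessChainRealiseWeak
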